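import Summits.CriticalPhenomena.PercolationContinuityZ3.Theorems.PercNearOneGluingNoHeavyLowerTailGiantOwnConnectionCov
import HarnessLib

/-!
# `NoHeavyLowerTail` (stmt-CriticalPhenomena-4575) — attached light/heavy transfer at a champion and the singleton
# Hall cut of the attached-champion inequality (XZ = CST)

Support file (prover `prim-lf-7`, lemma factory "k-cluster conditional association"; `--supports stmt-CriticalPhenomena-4575`).
No definitions, no named facts, no sorries.  Notation as in `…GiantExchange.lean` / `…GiantDiamond.lean`; ANY `A`, `j` (no ladder hypothesis —
the lead's `giantDiamond` is ladder-free).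
On the ladder `|A| ∈ {2j, 2j+1}` the open (5,2)-residual XZ = CST (`stub_attachedChampion`) reads
`μ(1 ≤ N ≤ j, c heavy) ≤ μ(N ≥ j+1, c light)` for a champion `c` (`μ(a light) ≤ μ(c light)` for all `a ∈ A`).

* `lightHeavy_le_heavyLight`  designation step: `μ(x light) ≤ μ(c light) ⇒ μ(x light, c heavy) ≤ μ(x heavy, c light)`;
* `attached_lightHeavy_le`    `μ(o↔x, x light, c heavy) ≤ μ(o↔x, x heavy, c light)` for a champion `c` (from `giant_diamond` and the
  designation step): an observer hanging on `x` sees "(x light, c heavy)" no more often than "(x heavy, c light)".  Summed over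
  `x ∈ A` this is the MOMENT weakening `E[N; 1≤N≤j, c heavy] ≤ E[N; N≥j+1, c light]` of XZ;
* `detached_heavyLight_le`    the dual: `μ(o↮c, c heavy, x light) ≤ μ(o↮c, c light, x heavy)` for a champion `c` — with the observer NOT on the
  champion, "(c heavy, x light)" is no more likely than "(c light, x heavy)"; this is the `|B| = 1` case of "the champion survives gluing the
  observer into `B`" (CB₁ ⇒ DS′₁ of prim-lf-7's batch 2/3b, the other route to the singleton transport arc);
* `singletonHallCut`          `μ(π(o) = {x}, c heavy) ≤ μ(x ∈ π(o), |π(o)| ≥ j+1, c light)` (`1 ≤ j`): the lonely-pocket transport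
  atom "PS1" of prim-lf-4's Hall decomposition of the cluster-size-transfer inequality, for every ladder level.
-/

noncomputable section

namespace Summit.CriticalPhenomena.PercolationContinuityZ3.Theorems

open MeasureTheory Set Literature.Probability.LatticeModels Literature.Probability.Percolation
open scoped Classical
open GiantExchange

variable {V : Type*}

/-- **Designation step (PROVED).**  If `μ(x light) ≤ μ(c light)` then `μ(x light, c heavy) ≤ μ(x heavy, c light)`
(cancel the common part `μ(x light, c light)`; for `x ∈ A` "not light" is "heavy"). [this file] -/
theorem lightHeavy_le_heavyLight [Fintype V] (w : Sym2 V → unitInterval) (A : Finset V) (x c : V) (j : ℕ)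
    (hcx : (prodBernoulli w).real {ω : BondConfig V | (A.filter fun a => ω ∈ openConn x a).card ≤ j} ≤
      (prodBernoulli w).real {ω : BondConfig V | (A.filter fun a => ω ∈ openConn c a).card ≤ j}) :
    (prodBernoulli w).real ({ω : BondConfig V | (A.filter fun a => ω ∈ openConn x a).card ≤ j} ∩
        {ω | j + 1 ≤ (A.filter fun a => ω ∈ openConn c a).card}) ≤
      (prodBernoulli w).real ({ω : BondConfig V | j + 1 ≤ (A.filter fun a => ω ∈ openConn x a).card} ∩
        {ω | (A.filter fun a => ω ∈ openConn c a).card ≤ j}) := by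
  set μ := prodBernoulli w with hμ
  set Lx : Set (BondConfig V) := {ω | (A.filter fun a => ω ∈ openConn x a).card ≤ j} with hLx
  set Hx : Set (BondConfig V) := {ω | j + 1 ≤ (A.filter fun a => ω ∈ openConn x a).card} with hHx
  set Lc : Set (BondConfig V) := {ω | (A.filter fun a => ω ∈ openConn c a).card ≤ j} with hLc
  set Hc : Set (BondConfig V) := {ω | j + 1 ≤ (A.filter fun a => ω ∈ openConn c a).card} with hHc
  have cx : Lxᶜ = Hx := by
    ext ω; simp only [mem_compl_iff, hLx, hHx, mem_setOf_eq, not_le]; omega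
  have cc : Lcᶜ = Hc := by
    ext ω; simp only [mem_compl_iff, hLc, hHc, mem_setOf_eq, not_le]; omega
  have s1 := OwnDisconnection.split w Lx Lc   -- μ(Lx ∩ Lc) + μ(Lx ∩ Lcᶜ) = μ(Lx)
  have s2 := OwnDisconnection.split w Lc Lx   -- μ(Lc ∩ Lx) + μ(Lc ∩ Lxᶜ) = μ(Lc)
  rw [cc] at s1
  rw [cx, inter_comm Lc Lx] at s2
  have e : (Hx ∩ Lc : Set (BondConfig V)) = Lc ∩ Hx := inter_comm _ _
  rw [e]
  linarith

/-- **Attached light/heavy transfer at a champion (PROVED, any `A`, `j`).**  Let `c` be a champion at level `j`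
(`μ(a light) ≤ μ(c light)` for every `a ∈ A`) and `x ∈ A`.  Then
`μ(o ↔ x, x light, c heavy) ≤ μ(o ↔ x, x heavy, c light)`:
seen from an observer attached to `x`, "`x` outside the giant, `c` inside" is no more likely than "`x` inside, `c` outside".
Proof: `giant_diamond` (product form) and the designation step `lightHeavy_le_heavyLight`.  Summed over `x` this is the
moment weakening `E[N; 1≤N≤j, c heavy] ≤ E[N; N≥j+1, c light]` of the attached-champion inequality (XZ = CST). [this file] -/
theorem attached_lightHeavy_le [Fintype V] (w : Sym2 V → unitInterval) (A : Finset V) (o x c : V) (j : ℕ)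
    (hcx : (prodBernoulli w).real {ω : BondConfig V | (A.filter fun a => ω ∈ openConn x a).card ≤ j} ≤
      (prodBernoulli w).real {ω : BondConfig V | (A.filter fun a => ω ∈ openConn c a).card ≤ j}) :
    (prodBernoulli w).real (openConn o x ∩ {ω | (A.filter fun a => ω ∈ openConn x a).card ≤ j} ∩
        {ω | j + 1 ≤ (A.filter fun a => ω ∈ openConn c a).card}) ≤
      (prodBernoulli w).real (openConn o x ∩ {ω | j + 1 ≤ (A.filter fun a => ω ∈ openConn x a).card} ∩
        {ω | (A.filter fun a => ω ∈ openConn c a).card ≤ j}) := by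
  set μ := prodBernoulli w with hμ
  set Lx : Set (BondConfig V) := {ω | (A.filter fun a => ω ∈ openConn x a).card ≤ j} with hLx
  set Hx : Set (BondConfig V) := {ω | j + 1 ≤ (A.filter fun a => ω ∈ openConn x a).card} with hHx
  set Lc : Set (BondConfig V) := {ω | (A.filter fun a => ω ∈ openConn c a).card ≤ j} with hLc
  set Hc : Set (BondConfig V) := {ω | j + 1 ≤ (A.filter fun a => ω ∈ openConn c a).card} with hHc
  have hD := giant_diamond w A o x c j         -- V * G ≤ R * F
  have hFG := lightHeavy_le_heavyLight w A x c j hcx   -- F ≤ G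
  set Vv := μ.real (openConn o x ∩ Lx ∩ Hc) with hVv
  set Rr := μ.real (openConn o x ∩ Hx ∩ Lc) with hRr
  set F := μ.real (Lx ∩ Hc) with hF
  set G := μ.real (Hx ∩ Lc) with hG
  have hR0 : 0 ≤ Rr := measureReal_nonneg
  have hV_le_F : Vv ≤ F := by
    apply measureReal_mono _ (measure_ne_top _ _)
    intro ω hω; exact hω.1.2 |> fun h => ⟨h, hω.2⟩
  rcases (measureReal_nonneg : 0 ≤ G).eq_or_lt with hG0 | hGpos
  · -- G = 0 forces F = 0 and hence V = 0
    have hF0 : F ≤ 0 := by rw [hG0]; exact hFG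
    linarith
  · have h1 : Vv * G ≤ Rr * G := le_trans hD (mul_le_mul_of_nonneg_left hFG hR0)
    exact le_of_mul_le_mul_right h1 hGpos

/-- **Detached light/heavy transfer at a champion (PROVED, any `A`, `j`) — dual of `attached_lightHeavy_le`.**
If `μ(x light) ≤ μ(c light)` and `x ∈ A`-style events as above, then `μ(o ↮ c, c heavy, x light) ≤ μ(o ↮ c, c light, x heavy)`:
with the observer NOT hanging on the champion, "(c heavy, x light)" is no more likely than "(c light, x heavy)".  Proof: the giant
diamond for the pair `(c, x)` bounds the attached part `μ(o↔c, c light, x heavy) ≤ μ(o↔c, c heavy, x light)·α/β`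
(`α = μ(c light, x heavy) ≥ β = μ(c heavy, x light)` by the designation step), and subtracting from `α ≥ β` leaves the claim.
This is the `|B| = 1` case of "the champion survives gluing the observer into `B`" (CB₁ of prim-lf-7's CANDIDATES.md). [this file] -/
theorem detached_heavyLight_le [Fintype V] (w : Sym2 V → unitInterval) (A : Finset V) (o x c : V) (j : ℕ)
    (hcx : (prodBernoulli w).real {ω : BondConfig V | (A.filter fun a => ω ∈ openConn x a).card ≤ j} ≤
      (prodBernoulli w).real {ω : BondConfig V | (A.filter fun a => ω ∈ openConn c a).card ≤ j}) :
    (prodBernoulli w).real ((openConn o c)ᶜ ∩ {ω | j + 1 ≤ (A.filter fun a => ω ∈ openConn c a).card} ∩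
        {ω | (A.filter fun a => ω ∈ openConn x a).card ≤ j}) ≤
      (prodBernoulli w).real ((openConn o c)ᶜ ∩ {ω | (A.filter fun a => ω ∈ openConn c a).card ≤ j} ∩
        {ω | j + 1 ≤ (A.filter fun a => ω ∈ openConn x a).card}) := by
  set μ := prodBernoulli w with hμ
  set Lx : Set (BondConfig V) := {ω | (A.filter fun a => ω ∈ openConn x a).card ≤ j} with hLx
  set Hx : Set (BondConfig V) := {ω | j + 1 ≤ (A.filter fun a => ω ∈ openConn x a).card} with hHx
  set Lc : Set (BondConfig V) := {ω | (A.filter fun a => ω ∈ openConn c a).card ≤ j} with hLc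
  set Hc : Set (BondConfig V) := {ω | j + 1 ≤ (A.filter fun a => ω ∈ openConn c a).card} with hHc
  -- giant diamond for the pair (c, x):  μ(o~c, c light, x heavy) μ(c heavy, x light) ≤ μ(o~c, c heavy, x light) μ(c light, x heavy)
  have hD := giant_diamond w A o c x j
  have hFG0 := lightHeavy_le_heavyLight w A x c j hcx        -- μ(Lx ∩ Hc) ≤ μ(Hx ∩ Lc)
  have hFG : μ.real (Hc ∩ Lx) ≤ μ.real (Lc ∩ Hx) := by
    rw [inter_comm Hc Lx, inter_comm Lc Hx]; exact hFG0
  set α := μ.real (Lc ∩ Hx) with hα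
  set β := μ.real (Hc ∩ Lx) with hβ
  set Qα := μ.real (openConn o c ∩ Lc ∩ Hx) with hQα        -- attached part of α
  set Qβ := μ.real (openConn o c ∩ Hc ∩ Lx) with hQβ        -- attached part of β
  change Qα * β ≤ Qβ * α at hD
  -- detached parts
  have sα : μ.real ((openConn o c)ᶜ ∩ Lc ∩ Hx) = α - Qα := by
    have := OwnDisconnection.split w (Lc ∩ Hx) (openConn o c)
    have e1 : (Lc ∩ Hx ∩ openConn o c : Set (BondConfig V)) = openConn o c ∩ Lc ∩ Hx := by
      ext ω; simp only [mem_inter_iff]; tauto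
    have e2 : (Lc ∩ Hx ∩ (openConn o c)ᶜ : Set (BondConfig V)) = (openConn o c)ᶜ ∩ Lc ∩ Hx := by
      ext ω; simp only [mem_inter_iff]; tauto
    rw [e1, e2] at this; linarith
  have sβ : μ.real ((openConn o c)ᶜ ∩ Hc ∩ Lx) = β - Qβ := by
    have := OwnDisconnection.split w (Hc ∩ Lx) (openConn o c)
    have e1 : (Hc ∩ Lx ∩ openConn o c : Set (BondConfig V)) = openConn o c ∩ Hc ∩ Lx := by
      ext ω; simp only [mem_inter_iff]; tauto
    have e2 : (Hc ∩ Lx ∩ (openConn o c)ᶜ : Set (BondConfig V)) = (openConn o c)ᶜ ∩ Hc ∩ Lx := by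
      ext ω; simp only [mem_inter_iff]; tauto
    rw [e1, e2] at this; linarith
  rw [sα, sβ]
  have hβ0 : 0 ≤ β := measureReal_nonneg
  have hQβ_le : Qβ ≤ β := measureReal_mono (fun ω hω => ⟨hω.1.2, hω.2⟩) (measure_ne_top _ _)
  have hQα0 : 0 ≤ Qα := measureReal_nonneg
  rcases hβ0.eq_or_lt with hβ00 | hβpos
  · -- β = 0 ⇒ Qβ = 0, claim is 0 ≤ α − Qα
    have hQβ0 : Qβ = 0 := le_antisymm (by linarith) measureReal_nonneg
    have hQα_le : Qα ≤ α := measureReal_mono (fun ω hω => ⟨hω.1.2, hω.2⟩) (measure_ne_top _ _)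
    rw [← hβ00, hQβ0]; linarith
  · -- β (β − Qβ) ≤ β (α − Qα):  β α − β Qα ≥ β α − α Qβ ≥ ... use Qα β ≤ Qβ α and (α − β)(β − Qβ) ≥ 0
    have h1 : β * (α - Qα) ≥ β * α - Qβ * α := by nlinarith [hD]
    have h2 : β * α - Qβ * α ≥ β * (β - Qβ) := by nlinarith [hFG, hQβ_le, hβ0]
    have h3 : β * (β - Qβ) ≤ β * (α - Qα) := le_trans h2 h1
    exact le_of_mul_le_mul_left h3 hβpos

/-- **The singleton Hall cut of the attached-champion inequality (PROVED, `1 ≤ j`, any `A`).**  For a champion `c` and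
a relay `x`:  `μ(π(o) = {x}, c heavy) ≤ μ(x ∈ π(o), |π(o)| ≥ j+1, c light)` — the demand of the lonely pocket `{x}` is covered
by the giant pockets through `x` with the champion outside (the transport atom "PS1" of the cluster-size-transfer / CIL♯ line).
Immediate from `attached_lightHeavy_le` and event inclusions. [this file] -/
theorem singletonHallCut [Fintype V] (w : Sym2 V → unitInterval) (A : Finset V) (o x c : V) (j : ℕ)
    (hj : 1 ≤ j)
    (hcx : (prodBernoulli w).real {ω : BondConfig V | (A.filter fun a => ω ∈ openConn x a).card ≤ j} ≤
      (prodBernoulli w).real {ω : BondConfig V | (A.filter fun a => ω ∈ openConn c a).card ≤ j}) :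
    (prodBernoulli w).real ({ω : BondConfig V | (A.filter fun a => ω ∈ openConn o a) = {x}} ∩
        {ω | j + 1 ≤ (A.filter fun a => ω ∈ openConn c a).card}) ≤
      (prodBernoulli w).real (openConn o x ∩ {ω : BondConfig V | j + 1 ≤ (A.filter fun a => ω ∈ openConn o a).card} ∩
        {ω | (A.filter fun a => ω ∈ openConn c a).card ≤ j}) := by
  refine le_trans (measureReal_mono ?_ (measure_ne_top _ _))
    (le_trans (attached_lightHeavy_le w A o x c j hcx) (measureReal_mono ?_ (measure_ne_top _ _)))
  · rintro ω ⟨hpo, hc⟩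
    simp only [mem_setOf_eq] at hpo
    have hox : (openGraph ω).Reachable o x := by
      have : x ∈ A.filter fun a => ω ∈ openConn o a := by rw [hpo]; exact Finset.mem_singleton_self x
      exact (Finset.mem_filter.1 this).2
    refine ⟨⟨hox, ?_⟩, hc⟩
    simp only [mem_setOf_eq]
    rw [← card_eq_of_reachable A hox, hpo, Finset.card_singleton]
    exact hj
  · rintro ω ⟨⟨hox, hh⟩, hl⟩
    refine ⟨⟨hox, ?_⟩, hl⟩
    simp only [mem_setOf_eq] at hh ⊢
    rw [card_eq_of_reachable A hox]
    exact hh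

end Summit.CriticalPhenomena.PercolationContinuityZ3.Theorems

end
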